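import Mathlib
import HarnessLib
import Summits.Ventures.LatticeQCDFlow.Exactness.BennettAcceptanceRatio
import Summits.Ventures.LatticeQCDFlow.Exactness.NCMCGeneralSpaceBennettRootLinearization
import Summits.Ventures.LatticeQCDFlow.Exactness.NCMCGeneralSpaceBennettBlocksRootVariance
import Summits.Ventures.LatticeQCDFlow.Exactness.NCMCGeneralSpaceTwoSampleBlocksCLT

/-!
# The block summand of Bennett's equation with `nf : nr = a : b`: monotone, bounded, linearisable; its mean, root, sensitivity and variance

HONEST FRAMING: exact (Metropolis-corrected) sampling algorithms for lattice gauge theory;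
figures of merit are autocorrelation/cost numbers at stated couplings and volumes; no
continuum-physics claim.

Venture `LatticeQCDFlow` (cell pub-lqcd), topic `Exactness`; FANOUT row 13 (`eng-snf`, GEN-15).
NEW WORK of the cell (bookkeeping), not a published result; nothing is cited as a fact (Bennett 1976
named only).  Prepares the instance "Bennett's equation with `a` forward and `b` reverse evolutions
per block, shift `M`" of the abstract root files `NCMCGeneralSpaceMonotoneRootConsistency/CLT.lean`:
the hypotheses those files consume, verified for the block summand
`ψ_d(x, y) = Σ_{l<a} σ(d − M − W(x l)) − Σ_{l<b} σ(W(y l) − (d − M))` on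
`X = (Fin a → E) × (Fin b → E)` under `μ = P_F^{⊗a} ⊗ P_R^{⊗b}`.

## Content

* `blocksSummand_strictMono` (`a ≥ 1`), `measurable_blocksSummand`, `abs_blocksSummand_le`
  (`|ψ_d| ≤ a + b`), `integrable_blocksSummand`.
* `integral_blocksSummand` — `E_μ ψ_d = a E_F σ(d − M − W) − b E_R σ(W − (d − M))`;
  **`CrooksPair.integral_blocksSummand_freeEnergy`** — with `M = log(a/b)` the population root is
  `ΔF`: `E_μ ψ_{ΔF} = 0` (`blocks_root`, `a e^{−M} = b`).
* `abs_sigmoid_shift_taylor_le`, `abs_neg_sigmoid_shift_taylor_le`, **`abs_blocksSummand_taylor_le`**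
  — the pointwise Taylor bound with `φ(x, y) = Σ σ'(d⋆ − M − W(x l)) + Σ σ'(W(y l) − (d⋆ − M))` and
  constant `L = (a + b)/4`.
* `measurable_blocksDeriv`, `integrable_blocksDeriv`, `integral_blocksDeriv` (`E_μ φ = a E_F σ' + b E_R σ'`),
  `variance_blocksSummand` (`Var_μ ψ_d = a Var_F σ(d − M − W) + b Var_R σ(W − (d − M))`).
* **`exists_blocksSummand_root`** — the sample block equation over `n ≥ 1` blocks has a root (it is
  the finite file's `barFn M` over `n·a` forward and `n·b` reverse works, `barFn_existsUnique_root`).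

Scope: deterministic and population statements (limit theorems: `NCMCGeneralSpaceBennettBlocksRoot`).
-/

namespace Summit.Ventures.LatticeQCDFlow.Exactness.GeneralNCMC

open MeasureTheory ProbabilityTheory Set Filter Finset
open scoped ENNReal NNReal Topology

variable {E : Type*} [MeasurableSpace E]

/-! ## The block summand: monotone, measurable, bounded -/

section Summand

variable (W : E → ℝ) (M : ℝ) {a b : ℕ}

omit [MeasurableSpace E] in
/-- The block summand is strictly increasing in `d` (`a ≥ 1`). -/
theorem blocksSummand_strictMono (ha : 0 < a) (p : (Fin a → E) × (Fin b → E)) :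
    StrictMono fun d : ℝ => (∑ l, Real.sigmoid (d - M - W (p.1 l))) -
      ∑ l, Real.sigmoid (W (p.2 l) - (d - M)) := by
  intro d d' hdd'
  haveI : Nonempty (Fin a) := ⟨⟨0, ha⟩⟩
  have h1 : ∑ l, Real.sigmoid (d - M - W (p.1 l)) < ∑ l, Real.sigmoid (d' - M - W (p.1 l)) :=
    sum_lt_sum_of_nonempty univ_nonempty fun l _ => Real.sigmoid_lt (by linarith)
  have h2 : ∑ l, Real.sigmoid (W (p.2 l) - (d' - M)) ≤ ∑ l, Real.sigmoid (W (p.2 l) - (d - M)) :=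
    sum_le_sum fun l _ => Real.sigmoid_le (by linarith)
  dsimp only
  linarith

variable {W} in
/-- The block summand is measurable in the block. -/
theorem measurable_blocksSummand (hW : Measurable W) (d : ℝ) :
    Measurable fun p : (Fin a → E) × (Fin b → E) => (∑ l, Real.sigmoid (d - M - W (p.1 l))) -
      ∑ l, Real.sigmoid (W (p.2 l) - (d - M)) := by
  refine Measurable.sub ?_ ?_
  · refine Finset.measurable_sum _ fun l _ => _root_.continuous_sigmoid.measurable.comp ?_
    exact measurable_const.sub (hW.comp ((measurable_pi_apply l).comp measurable_fst))
  · refine Finset.measurable_sum _ fun l _ => _root_.continuous_sigmoid.measurable.comp ?_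
    exact (hW.comp ((measurable_pi_apply l).comp measurable_snd)).sub measurable_const

omit [MeasurableSpace E] in
/-- `|ψ_d| ≤ a + b`. -/
theorem abs_blocksSummand_le (d : ℝ) (p : (Fin a → E) × (Fin b → E)) :
    |(∑ l, Real.sigmoid (d - M - W (p.1 l))) - ∑ l, Real.sigmoid (W (p.2 l) - (d - M))| ≤ a + b := by
  have h1 : |∑ l, Real.sigmoid (d - M - W (p.1 l))| ≤ a := by
    calc |∑ l, Real.sigmoid (d - M - W (p.1 l))| ≤ ∑ l, |Real.sigmoid (d - M - W (p.1 l))| :=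
          abs_sum_le_sum_abs _ _
      _ ≤ ∑ _l : Fin a, (1 : ℝ) := sum_le_sum fun l _ => by
          rw [abs_of_nonneg (Real.sigmoid_nonneg _)]; exact Real.sigmoid_le_one _
      _ = a := by simp
  have h2 : |∑ l, Real.sigmoid (W (p.2 l) - (d - M))| ≤ b := by
    calc |∑ l, Real.sigmoid (W (p.2 l) - (d - M))| ≤ ∑ l, |Real.sigmoid (W (p.2 l) - (d - M))| :=
          abs_sum_le_sum_abs _ _
      _ ≤ ∑ _l : Fin b, (1 : ℝ) := sum_le_sum fun l _ => by
          rw [abs_of_nonneg (Real.sigmoid_nonneg _)]; exact Real.sigmoid_le_one _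
      _ = b := by simp
  calc |(∑ l, Real.sigmoid (d - M - W (p.1 l))) - ∑ l, Real.sigmoid (W (p.2 l) - (d - M))|
      ≤ |∑ l, Real.sigmoid (d - M - W (p.1 l))| + |∑ l, Real.sigmoid (W (p.2 l) - (d - M))| :=
        abs_sub _ _
    _ ≤ a + b := add_le_add h1 h2

variable {W} in
/-- The block summand is integrable under any finite law on blocks. -/
theorem integrable_blocksSummand (hW : Measurable W) (μ : Measure ((Fin a → E) × (Fin b → E)))
    [IsFiniteMeasure μ] (d : ℝ) :
    Integrable (fun p : (Fin a → E) × (Fin b → E) => (∑ l, Real.sigmoid (d - M - W (p.1 l))) -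
      ∑ l, Real.sigmoid (W (p.2 l) - (d - M))) μ :=
  (integrable_const ((a : ℝ) + b)).mono' (measurable_blocksSummand M hW d).aestronglyMeasurable
    (Eventually.of_forall fun p => by rw [Real.norm_eq_abs]; exact abs_blocksSummand_le W M d p)

/-! ## The pointwise Taylor bound -/

omit [MeasurableSpace E] in
/-- One forward term: `|σ(d' − M − w) − σ(d − M − w) − σ'(d − M − w)(d' − d)| ≤ ¼ (d' − d)²`. -/
theorem abs_sigmoid_shift_taylor_le (w d d' : ℝ) :
    |Real.sigmoid (d' - M - w) - Real.sigmoid (d - M - w) -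
        Real.sigmoid (d - M - w) * (1 - Real.sigmoid (d - M - w)) * (d' - d)| ≤ 1 / 4 * (d' - d) ^ 2 := by
  refine abs_sub_sub_deriv_mul_le (f := fun t => Real.sigmoid (t - M - w))
    (f' := fun t => Real.sigmoid (t - M - w) * (1 - Real.sigmoid (t - M - w))) (by norm_num)
    (fun t => ?_) (fun s t => ?_) d d'
  · have := (Real.hasDerivAt_sigmoid (t - M - w)).comp t
      (((hasDerivAt_id t).sub_const M).sub_const w)
    simpa [Function.comp_def] using this
  · have := abs_dsigmoid_sub_dsigmoid_le (s - M - w) (t - M - w)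
    rwa [show s - M - w - (t - M - w) = s - t by ring] at this

omit [MeasurableSpace E] in
/-- One reverse term: `|−σ(w − (d' − M)) + σ(w − (d − M)) − σ'(w − (d − M))(d' − d)| ≤ ¼ (d' − d)²`. -/
theorem abs_neg_sigmoid_shift_taylor_le (w d d' : ℝ) :
    |-Real.sigmoid (w - (d' - M)) - -Real.sigmoid (w - (d - M)) -
        Real.sigmoid (w - (d - M)) * (1 - Real.sigmoid (w - (d - M))) * (d' - d)| ≤
      1 / 4 * (d' - d) ^ 2 := by
  refine abs_sub_sub_deriv_mul_le (f := fun t => -Real.sigmoid (w - (t - M)))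
    (f' := fun t => Real.sigmoid (w - (t - M)) * (1 - Real.sigmoid (w - (t - M)))) (by norm_num)
    (fun t => ?_) (fun s t => ?_) d d'
  · have := ((Real.hasDerivAt_sigmoid (w - (t - M))).comp t
      ((hasDerivAt_const t w).sub ((hasDerivAt_id t).sub_const M))).neg
    simpa [Function.comp_def, Pi.neg_def] using this
  · have := abs_dsigmoid_sub_dsigmoid_le (w - (s - M)) (w - (t - M))
    rwa [show w - (s - M) - (w - (t - M)) = -(s - t) by ring, abs_neg] at this

omit [MeasurableSpace E] in
/-- **Pointwise Taylor bound for the block summand** with constant `(a + b)/4`. -/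
theorem abs_blocksSummand_taylor_le (dstar d' : ℝ) (p : (Fin a → E) × (Fin b → E)) :
    |((∑ l, Real.sigmoid (d' - M - W (p.1 l))) - ∑ l, Real.sigmoid (W (p.2 l) - (d' - M))) -
        ((∑ l, Real.sigmoid (dstar - M - W (p.1 l))) - ∑ l, Real.sigmoid (W (p.2 l) - (dstar - M))) -
        ((∑ l, Real.sigmoid (dstar - M - W (p.1 l)) * (1 - Real.sigmoid (dstar - M - W (p.1 l)))) +
          ∑ l, Real.sigmoid (W (p.2 l) - (dstar - M)) * (1 - Real.sigmoid (W (p.2 l) - (dstar - M)))) *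
          (d' - dstar)| ≤ ((a : ℝ) + b) / 4 * (d' - dstar) ^ 2 := by
  set F := fun l : Fin a => Real.sigmoid (d' - M - W (p.1 l)) - Real.sigmoid (dstar - M - W (p.1 l)) -
    Real.sigmoid (dstar - M - W (p.1 l)) * (1 - Real.sigmoid (dstar - M - W (p.1 l))) * (d' - dstar) with hF
  set R := fun l : Fin b => -Real.sigmoid (W (p.2 l) - (d' - M)) - -Real.sigmoid (W (p.2 l) - (dstar - M)) -
    Real.sigmoid (W (p.2 l) - (dstar - M)) * (1 - Real.sigmoid (W (p.2 l) - (dstar - M))) * (d' - dstar)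
    with hR
  have hsplit : ((∑ l, Real.sigmoid (d' - M - W (p.1 l))) - ∑ l, Real.sigmoid (W (p.2 l) - (d' - M))) -
        ((∑ l, Real.sigmoid (dstar - M - W (p.1 l))) - ∑ l, Real.sigmoid (W (p.2 l) - (dstar - M))) -
        ((∑ l, Real.sigmoid (dstar - M - W (p.1 l)) * (1 - Real.sigmoid (dstar - M - W (p.1 l)))) +
          ∑ l, Real.sigmoid (W (p.2 l) - (dstar - M)) * (1 - Real.sigmoid (W (p.2 l) - (dstar - M)))) *
          (d' - dstar) = (∑ l, F l) + ∑ l, R l := by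
    simp only [hF, hR, sum_sub_distrib, sum_neg_distrib, ← sum_mul]
    ring
  rw [hsplit]
  have hFa : |∑ l, F l| ≤ (a : ℝ) / 4 * (d' - dstar) ^ 2 := by
    calc |∑ l, F l| ≤ ∑ l, |F l| := abs_sum_le_sum_abs _ _
      _ ≤ ∑ _l : Fin a, 1 / 4 * (d' - dstar) ^ 2 :=
          sum_le_sum fun l _ => abs_sigmoid_shift_taylor_le M (W (p.1 l)) dstar d'
      _ = (a : ℝ) / 4 * (d' - dstar) ^ 2 := by
          rw [sum_const, card_univ, Fintype.card_fin, nsmul_eq_mul]; ring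
  have hRb : |∑ l, R l| ≤ (b : ℝ) / 4 * (d' - dstar) ^ 2 := by
    calc |∑ l, R l| ≤ ∑ l, |R l| := abs_sum_le_sum_abs _ _
      _ ≤ ∑ _l : Fin b, 1 / 4 * (d' - dstar) ^ 2 :=
          sum_le_sum fun l _ => abs_neg_sigmoid_shift_taylor_le M (W (p.2 l)) dstar d'
      _ = (b : ℝ) / 4 * (d' - dstar) ^ 2 := by
          rw [sum_const, card_univ, Fintype.card_fin, nsmul_eq_mul]; ring
  calc |(∑ l, F l) + ∑ l, R l| ≤ |∑ l, F l| + |∑ l, R l| := abs_add_le _ _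
    _ ≤ (a : ℝ) / 4 * (d' - dstar) ^ 2 + (b : ℝ) / 4 * (d' - dstar) ^ 2 := add_le_add hFa hRb
    _ = ((a : ℝ) + b) / 4 * (d' - dstar) ^ 2 := by ring

/-! ## The derivative summand `φ` -/

variable {W} in
/-- `φ` is measurable. -/
theorem measurable_blocksDeriv (hW : Measurable W) (dstar : ℝ) :
    Measurable fun p : (Fin a → E) × (Fin b → E) =>
      (∑ l, Real.sigmoid (dstar - M - W (p.1 l)) * (1 - Real.sigmoid (dstar - M - W (p.1 l)))) +
        ∑ l, Real.sigmoid (W (p.2 l) - (dstar - M)) * (1 - Real.sigmoid (W (p.2 l) - (dstar - M))) := by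
  have hσ : Measurable Real.sigmoid := _root_.continuous_sigmoid.measurable
  refine Measurable.add ?_ ?_
  · refine Finset.measurable_sum _ fun l _ => ?_
    have hm : Measurable fun p : (Fin a → E) × (Fin b → E) => dstar - M - W (p.1 l) :=
      measurable_const.sub (hW.comp ((measurable_pi_apply l).comp measurable_fst))
    exact (hσ.comp hm).mul (measurable_const.sub (hσ.comp hm))
  · refine Finset.measurable_sum _ fun l _ => ?_
    have hm : Measurable fun p : (Fin a → E) × (Fin b → E) => W (p.2 l) - (dstar - M) :=
      (hW.comp ((measurable_pi_apply l).comp measurable_snd)).sub measurable_const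
    exact (hσ.comp hm).mul (measurable_const.sub (hσ.comp hm))

omit [MeasurableSpace E] in
/-- `0 ≤ φ ≤ (a + b)/4` pointwise; in particular `|φ| ≤ a + b`. -/
theorem abs_blocksDeriv_le (dstar : ℝ) (p : (Fin a → E) × (Fin b → E)) :
    |(∑ l, Real.sigmoid (dstar - M - W (p.1 l)) * (1 - Real.sigmoid (dstar - M - W (p.1 l)))) +
        ∑ l, Real.sigmoid (W (p.2 l) - (dstar - M)) * (1 - Real.sigmoid (W (p.2 l) - (dstar - M)))| ≤
      a + b := by
  have h1 : ∀ x : ℝ, 0 ≤ Real.sigmoid x * (1 - Real.sigmoid x) ∧ Real.sigmoid x * (1 - Real.sigmoid x) ≤ 1 :=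
    fun x => ⟨(dsigmoid_mem_Icc x).1, (dsigmoid_mem_Icc x).2.trans (by norm_num)⟩
  rw [abs_of_nonneg (add_nonneg (sum_nonneg fun l _ => (h1 _).1) (sum_nonneg fun l _ => (h1 _).1))]
  refine add_le_add ?_ ?_
  · calc (∑ l, Real.sigmoid (dstar - M - W (p.1 l)) * (1 - Real.sigmoid (dstar - M - W (p.1 l))))
        ≤ ∑ _l : Fin a, (1 : ℝ) := sum_le_sum fun l _ => (h1 _).2
      _ = a := by simp
  · calc (∑ l, Real.sigmoid (W (p.2 l) - (dstar - M)) * (1 - Real.sigmoid (W (p.2 l) - (dstar - M))))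
        ≤ ∑ _l : Fin b, (1 : ℝ) := sum_le_sum fun l _ => (h1 _).2
      _ = b := by simp

variable {W} in
/-- `φ` is integrable under any finite law on blocks. -/
theorem integrable_blocksDeriv (hW : Measurable W) (μ : Measure ((Fin a → E) × (Fin b → E)))
    [IsFiniteMeasure μ] (dstar : ℝ) :
    Integrable (fun p : (Fin a → E) × (Fin b → E) =>
      (∑ l, Real.sigmoid (dstar - M - W (p.1 l)) * (1 - Real.sigmoid (dstar - M - W (p.1 l)))) +
        ∑ l, Real.sigmoid (W (p.2 l) - (dstar - M)) * (1 - Real.sigmoid (W (p.2 l) - (dstar - M)))) μ :=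
  (integrable_const ((a : ℝ) + b)).mono' (measurable_blocksDeriv M hW dstar).aestronglyMeasurable
    (Eventually.of_forall fun p => by rw [Real.norm_eq_abs]; exact abs_blocksDeriv_le W M dstar p)

end Summand

/-! ## Means and variance under `P_F^{⊗a} ⊗ P_R^{⊗b}` -/

section TwoLaws

variable (μF μR : Measure E) [IsProbabilityMeasure μF] [IsProbabilityMeasure μR]
variable {W : E → ℝ} (M : ℝ) {a b : ℕ}

/-- `E ψ_d = a E_F σ(d − M − W) − b E_R σ(W − (d − M))` (marginals and block sums). -/
theorem integral_blocksSummand (hW : Measurable W) (d : ℝ) :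
    ∫ p, ((∑ l, Real.sigmoid (d - M - W (p.1 l))) - ∑ l, Real.sigmoid (W (p.2 l) - (d - M)))
        ∂((Measure.pi fun _ : Fin a => μF).prod (Measure.pi fun _ : Fin b => μR)) =
      a * (∫ x, Real.sigmoid (d - M - W x) ∂μF) - b * ∫ x, Real.sigmoid (W x - (d - M)) ∂μR := by
  have hiF : Integrable (fun x : Fin a → E => ∑ l, Real.sigmoid (d - M - W (x l)))
      (Measure.pi fun _ : Fin a => μF) := by
    refine integrable_finsetSum _ fun l _ => ?_
    exact (measurePreserving_eval (fun _ : Fin a => μF) l).integrable_comp_of_integrable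
      (integrable_sigmoid_comp (measurable_const.sub hW))
  have hiR : Integrable (fun y : Fin b → E => ∑ l, Real.sigmoid (W (y l) - (d - M)))
      (Measure.pi fun _ : Fin b => μR) := by
    refine integrable_finsetSum _ fun l _ => ?_
    exact (measurePreserving_eval (fun _ : Fin b => μR) l).integrable_comp_of_integrable
      (integrable_sigmoid_comp (hW.sub measurable_const))
  have hiF' : Integrable (fun p : (Fin a → E) × (Fin b → E) => ∑ l, Real.sigmoid (d - M - W (p.1 l)))
      ((Measure.pi fun _ : Fin a => μF).prod (Measure.pi fun _ : Fin b => μR)) :=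
    (measurePreserving_fst (μ := Measure.pi fun _ : Fin a => μF)
      (ν := Measure.pi fun _ : Fin b => μR)).integrable_comp_of_integrable hiF
  have hiR' : Integrable (fun p : (Fin a → E) × (Fin b → E) => ∑ l, Real.sigmoid (W (p.2 l) - (d - M)))
      ((Measure.pi fun _ : Fin a => μF).prod (Measure.pi fun _ : Fin b => μR)) :=
    (measurePreserving_snd (μ := Measure.pi fun _ : Fin a => μF)
      (ν := Measure.pi fun _ : Fin b => μR)).integrable_comp_of_integrable hiR
  rw [integral_sub hiF' hiR',
    integral_comp_of_measurePreserving
      (measurePreserving_fst (μ := Measure.pi fun _ : Fin a => μF) (ν := Measure.pi fun _ : Fin b => μR))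
      hiF.aestronglyMeasurable,
    integral_comp_of_measurePreserving
      (measurePreserving_snd (μ := Measure.pi fun _ : Fin a => μF) (ν := Measure.pi fun _ : Fin b => μR))
      hiR.aestronglyMeasurable,
    integral_blockSum μF (g := fun x => Real.sigmoid (d - M - W x))
      (integrable_sigmoid_comp (measurable_const.sub hW)),
    integral_blockSum μR (g := fun x => Real.sigmoid (W x - (d - M)))
      (integrable_sigmoid_comp (hW.sub measurable_const))]

/-- `E φ = a E_F σ'(d⋆ − M − W) + b E_R σ'(W − (d⋆ − M))`. -/
theorem integral_blocksDeriv (hW : Measurable W) (dstar : ℝ) :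
    ∫ p, ((∑ l, Real.sigmoid (dstar - M - W (p.1 l)) * (1 - Real.sigmoid (dstar - M - W (p.1 l)))) +
        ∑ l, Real.sigmoid (W (p.2 l) - (dstar - M)) * (1 - Real.sigmoid (W (p.2 l) - (dstar - M))))
        ∂((Measure.pi fun _ : Fin a => μF).prod (Measure.pi fun _ : Fin b => μR)) =
      a * (∫ x, Real.sigmoid (dstar - M - W x) * (1 - Real.sigmoid (dstar - M - W x)) ∂μF) +
        b * ∫ x, Real.sigmoid (W x - (dstar - M)) * (1 - Real.sigmoid (W x - (dstar - M))) ∂μR := by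
  have hgF : Integrable (fun x : E => Real.sigmoid (dstar - M - W x) * (1 - Real.sigmoid (dstar - M - W x))) μF := by
    have := integrable_sigmoid_mul_sigmoid (μ := μF) (f := fun x => dstar - M - W x)
      (g := fun x => W x - (dstar - M)) (measurable_const.sub hW) (hW.sub measurable_const)
    refine this.congr (Eventually.of_forall fun x => ?_)
    simp only
    rw [one_sub_sigmoid_sub (W x) (dstar - M)]
  have hgR : Integrable (fun x : E => Real.sigmoid (W x - (dstar - M)) * (1 - Real.sigmoid (W x - (dstar - M)))) μR := by
    have := integrable_sigmoid_mul_sigmoid (μ := μR) (f := fun x => W x - (dstar - M))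
      (g := fun x => dstar - M - W x) (hW.sub measurable_const) (measurable_const.sub hW)
    refine this.congr (Eventually.of_forall fun x => ?_)
    simp only
    rw [one_sub_sigmoid_sub (dstar - M) (W x)]
  have hiF : Integrable (fun x : Fin a → E => ∑ l, Real.sigmoid (dstar - M - W (x l)) *
      (1 - Real.sigmoid (dstar - M - W (x l)))) (Measure.pi fun _ : Fin a => μF) := by
    refine integrable_finsetSum _ fun l _ => ?_
    exact (measurePreserving_eval (fun _ : Fin a => μF) l).integrable_comp_of_integrable hgF
  have hiR : Integrable (fun y : Fin b → E => ∑ l, Real.sigmoid (W (y l) - (dstar - M)) *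
      (1 - Real.sigmoid (W (y l) - (dstar - M)))) (Measure.pi fun _ : Fin b => μR) := by
    refine integrable_finsetSum _ fun l _ => ?_
    exact (measurePreserving_eval (fun _ : Fin b => μR) l).integrable_comp_of_integrable hgR
  have hiF' : Integrable (fun p : (Fin a → E) × (Fin b → E) => ∑ l, Real.sigmoid (dstar - M - W (p.1 l)) *
      (1 - Real.sigmoid (dstar - M - W (p.1 l))))
      ((Measure.pi fun _ : Fin a => μF).prod (Measure.pi fun _ : Fin b => μR)) :=
    (measurePreserving_fst (μ := Measure.pi fun _ : Fin a => μF)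
      (ν := Measure.pi fun _ : Fin b => μR)).integrable_comp_of_integrable hiF
  have hiR' : Integrable (fun p : (Fin a → E) × (Fin b → E) => ∑ l, Real.sigmoid (W (p.2 l) - (dstar - M)) *
      (1 - Real.sigmoid (W (p.2 l) - (dstar - M))))
      ((Measure.pi fun _ : Fin a => μF).prod (Measure.pi fun _ : Fin b => μR)) :=
    (measurePreserving_snd (μ := Measure.pi fun _ : Fin a => μF)
      (ν := Measure.pi fun _ : Fin b => μR)).integrable_comp_of_integrable hiR
  rw [integral_add hiF' hiR',
    integral_comp_of_measurePreserving
      (measurePreserving_fst (μ := Measure.pi fun _ : Fin a => μF) (ν := Measure.pi fun _ : Fin b => μR))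
      hiF.aestronglyMeasurable,
    integral_comp_of_measurePreserving
      (measurePreserving_snd (μ := Measure.pi fun _ : Fin a => μF) (ν := Measure.pi fun _ : Fin b => μR))
      hiR.aestronglyMeasurable,
    integral_blockSum μF hgF, integral_blockSum μR hgR]

/-- `Var ψ_d = a Var_F σ(d − M − W) + b Var_R σ(W − (d − M))` (independent records). -/
theorem variance_blocksSummand (hW : Measurable W) (d : ℝ) :
    Var[fun p : (Fin a → E) × (Fin b → E) => (∑ l, Real.sigmoid (d - M - W (p.1 l))) -
        ∑ l, Real.sigmoid (W (p.2 l) - (d - M));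
        (Measure.pi fun _ : Fin a => μF).prod (Measure.pi fun _ : Fin b => μR)] =
      a * Var[fun x => Real.sigmoid (d - M - W x); μF] + b * Var[fun x => Real.sigmoid (W x - (d - M)); μR] := by
  have hF2 : MemLp (fun x : E => Real.sigmoid (d - M - W x)) 2 μF :=
    memLp_two_sigmoid_comp (measurable_const.sub hW)
  have hR2 : MemLp (fun x : E => Real.sigmoid (W x - (d - M))) 2 μR :=
    memLp_two_sigmoid_comp (hW.sub measurable_const)
  have h := variance_fst_sub_mul_snd' (Measure.pi fun _ : Fin a => μF) (Measure.pi fun _ : Fin b => μR)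
    (f := fun x : Fin a → E => ∑ l, Real.sigmoid (d - M - W (x l)))
    (g := fun y : Fin b → E => ∑ l, Real.sigmoid (W (y l) - (d - M)))
    (measurable_blockSum (_root_.continuous_sigmoid.measurable.comp (measurable_const.sub hW)))
    (measurable_blockSum (_root_.continuous_sigmoid.measurable.comp (hW.sub measurable_const)))
    (memLp_blockSum μF hF2) (memLp_blockSum μR hR2) 1
  simp only [one_mul, one_pow] at h
  rw [h, variance_blockSum μF hF2, variance_blockSum μR hR2]

end TwoLaws

/-! ## The root of the population block equation; existence of sample roots -/

section Root

variable {W : E → ℝ} {a b : ℕ}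

omit [MeasurableSpace E] in
/-- With `M = log(a/b)`: `a e^{(ΔF − M) − ΔF} = b`. -/
theorem mul_exp_sub_log_div (ha : 0 < a) (hb : 0 < b) (ΔF : ℝ) :
    (a : ℝ) * Real.exp (ΔF - Real.log ((a : ℝ) / b) - ΔF) = b := by
  have ha' : (0 : ℝ) < a := by exact_mod_cast ha
  have hb' : (0 : ℝ) < b := by exact_mod_cast hb
  rw [show ΔF - Real.log ((a : ℝ) / b) - ΔF = -Real.log ((a : ℝ) / b) by ring, Real.exp_neg,
    Real.exp_log (div_pos ha' hb')]
  field_simp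

omit [MeasurableSpace E] in
/-- **The sample block equation over `n ≥ 1` blocks has a root** (it is the finite file's Bennett
equation `barFn M` over the `n·a` forward works and the `n·b` reverse works `−W`, which has exactly
one root, `barFn_existsUnique_root`). -/
theorem exists_blocksSummand_root (W : E → ℝ) (M : ℝ) (ha : 0 < a) (hb : 0 < b) {n : ℕ} (hn : 1 ≤ n)
    (ω : ℕ → (Fin a → E) × (Fin b → E)) :
    ∃ d : ℝ, ∑ i ∈ range n, ((∑ l, Real.sigmoid (d - M - W ((ω i).1 l))) -
      ∑ l, Real.sigmoid (W ((ω i).2 l) - (d - M))) = 0 := by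
  haveI : Nonempty (Fin n × Fin a) := ⟨(⟨0, hn⟩, ⟨0, ha⟩)⟩
  haveI : Nonempty (Fin n × Fin b) := ⟨(⟨0, hn⟩, ⟨0, hb⟩)⟩
  obtain ⟨d, hd, -⟩ := barFn_existsUnique_root M (fun q : Fin n × Fin a => W ((ω q.1).1 q.2))
    (fun q : Fin n × Fin b => -W ((ω q.1).2 q.2))
  refine ⟨d, ?_⟩
  rw [← hd]
  unfold barFn fermiWeight
  rw [sum_sub_distrib, Fintype.sum_prod_type, Fintype.sum_prod_type,
    Fin.sum_univ_eq_sum_range (fun i => ∑ l : Fin a, 1 / (1 + Real.exp (M + W ((ω i).1 l) - d))) n,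
    Fin.sum_univ_eq_sum_range (fun i => ∑ l : Fin b, 1 / (1 + Real.exp (-M + -W ((ω i).2 l) + d))) n]
  congr 1
  · refine sum_congr rfl fun i _ => sum_congr rfl fun l _ => ?_
    rw [Real.sigmoid_def, one_div, show M + W ((ω i).1 l) - d = -(d - M - W ((ω i).1 l)) by ring]
  · refine sum_congr rfl fun i _ => sum_congr rfl fun l _ => ?_
    rw [Real.sigmoid_def, one_div, show -M + -W ((ω i).2 l) + d = -(W ((ω i).2 l) - (d - M)) by ring]

end Root

namespace CrooksPair

variable {Ω : Type*} [MeasurableSpace Ω]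
variable {ν₀ ν₁ : Measure Ω} {κF κR : Kernel Ω E} {s e : E → Ω} {W : E → ℝ} {a b : ℕ}

/-- **With `M = log(a/b)` the population root of the block equation is `ΔF`**: `E ψ_{ΔF} = 0` under
`P_F^{⊗a} ⊗ P_R^{⊗b}`. -/
theorem integral_blocksSummand_freeEnergy [IsFiniteMeasure ν₀] [IsFiniteMeasure ν₁]
    [IsMarkovKernel κF] [IsMarkovKernel κR] (h0 : ν₀ univ ≠ 0) (h1 : ν₁ univ ≠ 0)
    (h : CrooksPair ν₀ ν₁ κF κR s e W) {ΔF : ℝ}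
    (hΔF : Real.exp (-ΔF) = ((ν₀ univ)⁻¹ * ν₁ univ).toReal) (ha : 0 < a) (hb : 0 < b) :
    haveI := isProbabilityMeasure_fwdPathLaw ν₀ h0 κF
    haveI := isProbabilityMeasure_fwdPathLaw ν₁ h1 κR
    ∫ p, ((∑ l, Real.sigmoid (ΔF - Real.log ((a : ℝ) / b) - W (p.1 l))) -
        ∑ l, Real.sigmoid (W (p.2 l) - (ΔF - Real.log ((a : ℝ) / b))))
        ∂((Measure.pi fun _ : Fin a => fwdPathLaw ν₀ κF).prod (Measure.pi fun _ : Fin b => fwdPathLaw ν₁ κR)) = 0 := by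
  haveI := isProbabilityMeasure_fwdPathLaw ν₀ h0 κF
  haveI := isProbabilityMeasure_fwdPathLaw ν₁ h1 κR
  rw [integral_blocksSummand (fwdPathLaw ν₀ κF) (fwdPathLaw ν₁ κR) (Real.log ((a : ℝ) / b)) h.measurable_W ΔF,
    h.blocks_root h0 h1 hΔF (mul_exp_sub_log_div ha hb ΔF), sub_self]

end CrooksPair

end Summit.Ventures.LatticeQCDFlow.Exactness.GeneralNCMC
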